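import Mathlib.LinearAlgebra.Matrix.Trace
import Mathlib.Data.Matrix.Basic
import Mathlib.Algebra.BigOperators.Fin
import Mathlib.Algebra.Group.Fin.Basic
import Mathlib.Data.Fin.Tuple.Basic
import Mathlib.Tactic.Abel
import Mathlib.Tactic.Ring
import HarnessLib

/-!
# Traces of powers as sums over closed walks, and the triangularity of the Gelfand–Casimir symbols on the mirabolic slice

Topic `Algebra/Lie`; namespace `Literature.Algebra.Lie.MirabolicKostant`. Pure matrix algebra
over a commutative ring `R` (definitions with bodies and theorems; no named fact).

**Closed walks.** For `M ∈ M_n(R)` and `k ≥ 1`, `trace (M^k) = Σ_w Π_a M_{w(a), w(a+1)}`, the sum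
over all maps `w : ℤ/k → {0, …, n-1}` (`Fin k → Fin n`, cyclic successor)
(`trace_pow_eq_sum_cycProd`; via the path expansion of `(M^k)_{ii'}`, `pow_apply_eq_sum_pathProd`).

**The mirabolic slice.** Let `Z ∈ M_n(R)` have prescribed superdiagonal `Z_{a,a+1} = c_a` and zeros
above it (`Z_{ab} = 0` for `b ≥ a + 2`); the entries on and below the diagonal are free. This is the
commutative shadow of `U(𝔤𝔩_n)` modulo the LEFT ideal of a non-degenerate Whittaker character
(`e_{a,a+1} - c_a`, `e_{ab}` for `b ≥ a+2`), i.e. the coordinate ring of Kostant's slice for the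
mirabolic normal form. The symbol of the Gelfand–Casimir generator
`T_k = Σ e_{i₀i₁} e_{i₁i₂} ⋯ e_{i_{k-1}i₀}` of `𝔷(𝔤𝔩_n)` is `trace (Z^k)`, and the main theorem of
this file is its **triangularity in the last-row variables** (`j = n - k`):

  `trace (Z^k) = trace (Z'^k) + k · (c_j c_{j+1} ⋯ c_{n-2}) · Z_{n-1, j}`,

where `Z'` is `Z` with the last-row entries `Z_{n-1, i}`, `i ≤ j`, replaced by `0`
(`trace_pow_eq_trace_pow_zeroLastRow_add`). In words: `trace (Z^k)` does not involve the last-row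
variables `Z_{n-1,i}` with `i < n - k`, and involves `Z_{n-1,n-k}` exactly linearly with the unit
coefficient `k Π c` (when `k` and the `c_a` are invertible). Reason: a closed walk of length `k` all
of whose steps are "down or level" (free entries) or "up by one" (a `c_a`) and which uses the step
`n - 1 → i` with `i ≤ n - k` must climb back from `i` to `n - 1` in `k - 1` steps, forcing `i = n - k`
and the walk `j → j+1 → ⋯ → n-1 → j` up to its `k` rotations (`eq_rotate_specialWalk_of_noBigJump`).
By downward induction on `j` this shows that, modulo the Whittaker left ideal and the central
characters, the last-row letters `e_{n-1,j}` reduce to the mirabolic subalgebra — the graded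
(symbol-level) half of the Casimir–Whittaker reduction `U(𝔤𝔩_n) = 𝔫_θ U(𝔤𝔩_n) + U(𝔭_n) 𝔷`
behind the automatic continuity of Whittaker functionals (Kostant (1978), §2; the instance `n = 3`
is `Literature.Algebra.Lie.GL3Whittaker`, where the cubic generator is needed for `e_{2,0}`).

## References

* B. Kostant, *On Whittaker vectors and representation theory*, Invent. Math. 48 (1978), 101–184,
  §1.2 (the slice `f + 𝔟`), §2 [Kostant1978Whittaker].
* I. M. Gelfand, *The center of an infinitesimal group ring*, Mat. Sb. 26 (1950), 103–112 (the
  generators `T_k`) [folklore].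
* R. P. Stanley, *Enumerative Combinatorics* I, 2nd ed. (2012), §4.7 (transfer-matrix method:
  `trace (M^k)` counts closed walks) [folklore].
-/

namespace Literature.Algebra.Lie.MirabolicKostant

open Matrix Finset

variable {R : Type*} [CommRing R] {n : ℕ}

/-! ### 1. Paths, closed walks, and traces of powers -/

/-- The product of the entries of `M` along a path `v₀ → v₁ → ⋯ → v_k` (`k` steps). [folklore] -/
def pathProd (M : Matrix (Fin n) (Fin n) R) {k : ℕ} (v : Fin (k + 1) → Fin n) : R :=
  ∏ a : Fin k, M (v a.castSucc) (v a.succ)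

/-- The product of the entries of `M` along a closed walk `w : ℤ/k → Fin n` (cyclic successor).
[folklore] -/
def cycProd (M : Matrix (Fin n) (Fin n) R) {k : ℕ} [NeZero k] (w : Fin k → Fin n) : R :=
  ∏ a : Fin k, M (w a) (w (a + 1))

/-- Appending one step to a path multiplies the path product by the new entry. [folklore] -/
theorem pathProd_snoc (M : Matrix (Fin n) (Fin n) R) {k : ℕ} (v : Fin (k + 1) → Fin n) (x : Fin n) :
    pathProd M (Fin.snoc v x : Fin (k + 2) → Fin n) = pathProd M v * M (v (Fin.last k)) x := by
  unfold pathProd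
  rw [Fin.prod_univ_castSucc]
  congr 1
  · refine Finset.prod_congr rfl fun a _ => ?_
    have h1 : (Fin.snoc v x : Fin (k + 2) → Fin n) a.castSucc.castSucc = v a.castSucc := by
      rw [Fin.snoc_castSucc]
    have h2 : (Fin.snoc v x : Fin (k + 2) → Fin n) a.castSucc.succ = v a.succ := by
      rw [Fin.succ_castSucc, Fin.snoc_castSucc]
    rw [h1, h2]
  · rw [Fin.snoc_castSucc, Fin.succ_last, Fin.snoc_last]

/-- **Entries of powers as sums over paths**: `(M^k)_{ii'} = Σ_{v : v₀ = i, v_k = i'} Π_a M_{v_a v_{a+1}}`.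
[folklore] -/
theorem pow_apply_eq_sum_pathProd (M : Matrix (Fin n) (Fin n) R) :
    ∀ (k : ℕ) (i i' : Fin n), (M ^ k) i i' =
      ∑ v : Fin (k + 1) → Fin n, if v 0 = i ∧ v (Fin.last k) = i' then pathProd M v else 0
  | 0, i, i' => by
    rw [pow_zero, Matrix.one_apply, ← (Equiv.funUnique (Fin 1) (Fin n)).symm.sum_comp]
    have hp : ∀ x : Fin n, pathProd M ((Equiv.funUnique (Fin 1) (Fin n)).symm x : Fin (0 + 1) → Fin n) = 1 :=
      fun x => by unfold pathProd; simp
    simp only [hp, Fin.last_zero]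
    simp only [Equiv.funUnique_symm_apply, uniqueElim_const]
    by_cases h : i = i'
    · subst h
      simp only [and_self, if_true]
      rw [Finset.sum_ite_eq' Finset.univ i (fun _ => (1 : R)), if_pos (Finset.mem_univ _)]
    · rw [if_neg h]
      refine (Finset.sum_eq_zero fun x _ => ?_).symm
      rw [if_neg]
      rintro ⟨rfl, rfl⟩
      exact h rfl
  | k + 1, i, i' => by
    rw [pow_succ, Matrix.mul_apply]
    simp_rw [pow_apply_eq_sum_pathProd M k i, Finset.sum_mul]
    rw [Finset.sum_comm]
    have hL : ∀ v : Fin (k + 1) → Fin n,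
        (∑ l, (if v 0 = i ∧ v (Fin.last k) = l then pathProd M v else 0) * M l i') =
          if v 0 = i then pathProd M v * M (v (Fin.last k)) i' else 0 := by
      intro v
      by_cases h0 : v 0 = i
      · simp only [h0, true_and, if_true, ite_mul, zero_mul]
        rw [Finset.sum_ite_eq Finset.univ (v (Fin.last k)) (fun l => pathProd M v * M l i'),
          if_pos (Finset.mem_univ _)]
      · simp [h0]
    simp_rw [hL]
    -- reindex paths of length `k + 1` as (last vertex, path of length `k`)
    rw [← (Fin.snocEquiv fun _ : Fin (k + 2) => Fin n).sum_comp, Fintype.sum_prod_type, Finset.sum_comm]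
    refine Finset.sum_congr rfl fun v _ => ?_
    have h0 : ∀ l : Fin n, (Fin.snoc v l : Fin (k + 2) → Fin n) 0 = v 0 := fun l => by
      rw [← Fin.castSucc_zero, Fin.snoc_castSucc]
    have hre : ∀ l : Fin n, (fun a => (Fin.snocEquiv fun _ : Fin (k + 2) => Fin n) (l, v) a) =
        (Fin.snoc v l : Fin (k + 2) → Fin n) := fun l => rfl
    simp only [hre, Fin.snoc_last, pathProd_snoc, h0]
    by_cases hv : v 0 = i
    · simp only [hv, true_and, if_true]
      rw [Finset.sum_ite_eq' Finset.univ i' (fun l => pathProd M v * M (v (Fin.last k)) l),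
        if_pos (Finset.mem_univ _)]
    · simp [hv]

/-- The cyclic successor of a based closed walk agrees with the closing path. [folklore] -/
theorem snoc_succ_eq {k : ℕ} [NeZero k] (w : Fin k → Fin n) (a : Fin k) :
    (Fin.snoc w (w 0) : Fin (k + 1) → Fin n) a.succ = w (a + 1) := by
  by_cases h : a.val + 1 < k
  · have hsucc : a.succ = (⟨a.val + 1, h⟩ : Fin k).castSucc := by
      ext; simp
    rw [hsucc, Fin.snoc_castSucc]
    congr 1
    ext
    rw [Fin.val_add]
    simp [Nat.mod_eq_of_lt h]
  · have hk : a.val + 1 = k := by omega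
    have hsucc : a.succ = Fin.last k := by
      ext; simp [hk]
    rw [hsucc, Fin.snoc_last]
    congr 1
    ext
    rw [Fin.val_add, Fin.val_zero]
    have : (1 : Fin k).val = 1 % k := Fin.val_one' k
    rw [this, Nat.add_mod_mod, hk, Nat.mod_self]

/-- **Traces of powers as sums over closed walks** (transfer-matrix formula):
`trace (M^k) = Σ_{w : ℤ/k → Fin n} Π_a M_{w(a), w(a+1)}` for `k ≥ 1`. [folklore] -/
theorem trace_pow_eq_sum_cycProd (M : Matrix (Fin n) (Fin n) R) (k : ℕ) [NeZero k] :
    trace (M ^ k) = ∑ w : Fin k → Fin n, cycProd M w := by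
  obtain ⟨k', rfl⟩ : ∃ k', k = k' + 1 := ⟨k - 1, (Nat.succ_pred_eq_of_ne_zero (NeZero.ne k)).symm⟩
  rw [Matrix.trace]
  simp only [Matrix.diag_apply, pow_apply_eq_sum_pathProd M (k' + 1)]
  -- `Σ_i Σ_v [v₀ = i ∧ v_last = i] P v = Σ_v [v₀ = v_last] P v`
  rw [Finset.sum_comm]
  have h1 : ∀ v : Fin (k' + 2) → Fin n,
      (∑ i, if v 0 = i ∧ v (Fin.last (k' + 1)) = i then pathProd M v else 0) =
        if v (Fin.last (k' + 1)) = v 0 then pathProd M v else 0 := by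
    intro v
    by_cases h : v (Fin.last (k' + 1)) = v 0
    · rw [if_pos h]
      rw [Finset.sum_eq_single (v 0)]
      · rw [if_pos ⟨rfl, h⟩]
      · intro b _ hb
        rw [if_neg]
        rintro ⟨h1, _⟩
        exact hb h1.symm
      · intro h'; exact absurd (Finset.mem_univ _) h'
    · rw [if_neg h]
      refine Finset.sum_eq_zero fun i _ => ?_
      rw [if_neg]
      rintro ⟨h1, h2⟩
      exact h (h2.trans h1.symm)
  simp_rw [h1]
  -- reindex closed paths by (closing vertex, walk) and collapse the closing vertex
  rw [← (Fin.snocEquiv fun _ : Fin (k' + 2) => Fin n).sum_comp, Fintype.sum_prod_type, Finset.sum_comm]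
  refine Finset.sum_congr rfl fun w _ => ?_
  have hre : ∀ l : Fin n, (fun a => (Fin.snocEquiv fun _ : Fin (k' + 2) => Fin n) (l, w) a) =
      (Fin.snoc w l : Fin (k' + 2) → Fin n) := fun l => rfl
  have h0 : ∀ l : Fin n, (Fin.snoc w l : Fin (k' + 2) → Fin n) 0 = w 0 := fun l => by
    rw [← Fin.castSucc_zero, Fin.snoc_castSucc]
  simp only [hre, Fin.snoc_last, h0]
  rw [Finset.sum_ite_eq' Finset.univ (w 0) (fun l => pathProd M (Fin.snoc w l : Fin (k' + 2) → Fin n)),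
    if_pos (Finset.mem_univ _)]
  -- the closed path product is the cyclic product
  unfold pathProd cycProd
  refine Finset.prod_congr rfl fun a _ => ?_
  rw [Fin.snoc_castSucc, snoc_succ_eq]

/-- Cyclic products are invariant under rotation of the walk. [folklore] -/
theorem cycProd_rotate (M : Matrix (Fin n) (Fin n) R) {k : ℕ} [NeZero k] (w : Fin k → Fin n) (r : Fin k) :
    cycProd M (fun a => w (a + r)) = cycProd M w := by
  unfold cycProd
  exact Fintype.prod_equiv (Equiv.addRight r) _ _ fun a => by
    simp only [Equiv.coe_addRight, add_right_comm]

/-! ### 2. The mirabolic slice: superdiagonal constants, zeros above -/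

/-- **The mirabolic (Kostant) slice**: matrices with prescribed superdiagonal `Z_{a,a+1} = c_a` and
zeros above the superdiagonal; the entries on and below the diagonal are free. These are the
commutative symbols of `U(𝔤𝔩_n)` modulo the left ideal of the non-degenerate Whittaker character
`e_{a,a+1} ↦ c_a`. [cite: Kostant1978Whittaker, §1.2] -/
structure IsMirabolicSlice (c : Fin n → R) (Z : Matrix (Fin n) (Fin n) R) : Prop where
  /-- the superdiagonal is prescribed -/
  superdiag : ∀ a b : Fin n, a.val + 1 = b.val → Z a b = c a
  /-- zeros above the superdiagonal -/
  above : ∀ a b : Fin n, a.val + 2 ≤ b.val → Z a b = 0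

/-- Zeroing the last-row entries `Z_{n-1, i}`, `i ≤ j`. [folklore] -/
def zeroLastRow (j : ℕ) (Z : Matrix (Fin n) (Fin n) R) : Matrix (Fin n) (Fin n) R :=
  fun a b => if a.val = n - 1 ∧ b.val ≤ j then 0 else Z a b

/-- Entries of `zeroLastRow`. [folklore] -/
theorem zeroLastRow_apply (j : ℕ) (Z : Matrix (Fin n) (Fin n) R) (a b : Fin n) :
    zeroLastRow j Z a b = if a.val = n - 1 ∧ b.val ≤ j then 0 else Z a b := rfl

/-- Zeroing last-row entries below the diagonal keeps the slice conditions. [folklore] -/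
theorem IsMirabolicSlice.zeroLastRow {c : Fin n → R} {Z : Matrix (Fin n) (Fin n) R}
    (hZ : IsMirabolicSlice c Z) (j : ℕ) : IsMirabolicSlice c (zeroLastRow j Z) := by
  refine ⟨fun a b hab => ?_, fun a b hab => ?_⟩
  · rw [zeroLastRow_apply, if_neg, hZ.superdiag a b hab]
    rintro ⟨ha, -⟩
    have := b.isLt
    omega
  · rw [zeroLastRow_apply]
    split_ifs
    · rfl
    · exact hZ.above a b hab

section Slice

variable {c : Fin n → R} {Z : Matrix (Fin n) (Fin n) R} {k : ℕ}

/-- A walk **uses a zeroed entry**: some step goes from the last index `n - 1` to an index `≤ n - (k+1)`.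
[folklore] -/
def UsesZeroed (n k : ℕ) (w : Fin (k + 1) → Fin n) : Prop :=
  ∃ a : Fin (k + 1), (w a).val = n - 1 ∧ (w (a + 1)).val ≤ n - (k + 1)

/-- Off the zeroed entries the two cyclic products agree. [folklore] -/
theorem cycProd_zeroLastRow_of_not {w : Fin (k + 1) → Fin n} (h : ¬ UsesZeroed n k w) :
    cycProd (zeroLastRow (n - (k + 1)) Z) w = cycProd Z w := by
  unfold cycProd
  refine Finset.prod_congr rfl fun a _ => ?_
  rw [zeroLastRow_apply, if_neg]
  intro hab
  exact h ⟨a, hab.1, hab.2⟩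

/-- On a walk using a zeroed entry the zeroed cyclic product vanishes. [folklore] -/
theorem cycProd_zeroLastRow_of {w : Fin (k + 1) → Fin n} (h : UsesZeroed n k w) :
    cycProd (zeroLastRow (n - (k + 1)) Z) w = 0 := by
  obtain ⟨a, ha, hb⟩ := h
  unfold cycProd
  exact Finset.prod_eq_zero (Finset.mem_univ a) (by rw [zeroLastRow_apply, if_pos ⟨ha, hb⟩])

/-- A step climbing by two or more kills the cyclic product on the slice. [folklore] -/
theorem cycProd_eq_zero_of_bigJump (hZ : IsMirabolicSlice c Z) {w : Fin (k + 1) → Fin n}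
    (h : ∃ a : Fin (k + 1), (w a).val + 2 ≤ (w (a + 1)).val) : cycProd Z w = 0 := by
  obtain ⟨a, ha⟩ := h
  unfold cycProd
  exact Finset.prod_eq_zero (Finset.mem_univ a) (hZ.above _ _ ha)

/-- **The special closed walk** `j → j+1 → ⋯ → n-1 → j`, `j = n - (k+1)`. [folklore] -/
def specialWalk (n k : ℕ) (hkn : k + 1 ≤ n) (m : Fin (k + 1)) : Fin n :=
  ⟨n - (k + 1) + m.val, by have := m.isLt; omega⟩

/-- Values of the special walk. [folklore] -/
@[simp] theorem specialWalk_val (hkn : k + 1 ≤ n) (m : Fin (k + 1)) :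
    (specialWalk n k hkn m).val = n - (k + 1) + m.val := rfl

open Fin.NatCast in
/-- **Rigidity of closed walks through a zeroed entry.** A closed walk of length `k + 1` whose steps
climb by at most one and which steps from `n - 1` to an index `≤ n - (k+1)` is a rotation of the
special walk: it must climb back by exactly one at every remaining step. [folklore] -/
theorem eq_rotate_specialWalk_of_noBigJump (hkn : k + 1 ≤ n) {w : Fin (k + 1) → Fin n}
    (hP : UsesZeroed n k w) (hno : ∀ a : Fin (k + 1), (w (a + 1)).val ≤ (w a).val + 1) :
    ∃ r : Fin (k + 1), w = fun a => specialWalk n k hkn (a + r) := by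
  obtain ⟨a₀, ha₀, hb₀⟩ := hP
  -- `b m = a₀ + 1 + m`
  set b : ℕ → Fin (k + 1) := fun m => a₀ + 1 + (m : Fin (k + 1)) with hb
  have hb0 : b 0 = a₀ + 1 := by simp [hb]
  have hbsucc : ∀ m, b (m + 1) = b m + 1 := fun m => by
    simp only [hb, Nat.cast_succ, add_assoc]
  have hbk : b k = a₀ := by
    have h1 : b k + 1 = b (k + 1) := (hbsucc k).symm
    have h2 : b (k + 1) = a₀ + 1 := by
      simp only [hb, Fin.natCast_self, add_zero]
    have := h1.trans h2
    exact add_right_cancel this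
  -- upper bounds by forward induction
  have hup : ∀ m, (w (b m)).val ≤ n - (k + 1) + m := by
    intro m
    induction m with
    | zero => rw [hb0]; simpa using hb₀
    | succ m ih => rw [hbsucc]; exact (hno _).trans (by omega)
  -- lower bounds by backward induction
  have hdown : ∀ d m, m + d = k → n - 1 ≤ (w (b m)).val + d := by
    intro d
    induction d with
    | zero => intro m hm; rw [add_zero] at hm; subst hm; rw [hbk, ha₀]; simp
    | succ d ih =>
      intro m hm
      have := ih (m + 1) (by omega)
      rw [hbsucc] at this
      have := hno (b m)
      omega
  have heq : ∀ m, m ≤ k → (w (b m)).val = n - (k + 1) + m := by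
    intro m hm
    have h1 := hup m
    have h2 := hdown (k - m) m (by omega)
    omega
  refine ⟨-(a₀ + 1), funext fun a => Fin.ext ?_⟩
  -- `a = b m` with `m = (a - (a₀ + 1)).val`
  set m : ℕ := (a + -(a₀ + 1)).val with hm
  have hmk : m ≤ k := Nat.lt_succ_iff.mp (a + -(a₀ + 1)).isLt
  have ha : a = b m := by
    simp only [hb, hm, Fin.cast_val_eq_self]; abel
  rw [specialWalk_val]
  conv_lhs => rw [ha]
  rw [heq m hmk]

/-- The cyclic product of the special walk: `c_j c_{j+1} ⋯ c_{n-2} · Z_{n-1, j}`. [folklore] -/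
theorem cycProd_specialWalk (hZ : IsMirabolicSlice c Z) (hkn : k + 1 ≤ n) :
    cycProd Z (specialWalk n k hkn) =
      (∏ m : Fin k, c ⟨n - (k + 1) + m.val, by have := m.isLt; omega⟩) *
        Z ⟨n - 1, by omega⟩ ⟨n - (k + 1), by omega⟩ := by
  unfold cycProd
  rw [Fin.prod_univ_castSucc]
  congr 1
  · refine Finset.prod_congr rfl fun m _ => ?_
    refine hZ.superdiag _ _ ?_
    simp only [specialWalk_val, Fin.val_castSucc, Fin.val_add_one_of_lt (Fin.castSucc_lt_last m)]
    omega
  · have h1 : specialWalk n k hkn (Fin.last k) = ⟨n - 1, by omega⟩ := by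
      ext; simp; omega
    have h2 : specialWalk n k hkn (Fin.last k + 1) = ⟨n - (k + 1), by omega⟩ := by
      ext; simp [Fin.last_add_one]
    rw [h1, h2]

/-- Rotations of the special walk use a zeroed entry. [folklore] -/
theorem usesZeroed_rotate_specialWalk (hkn : k + 1 ≤ n) (r : Fin (k + 1)) :
    UsesZeroed n k (fun a => specialWalk n k hkn (a + r)) := by
  refine ⟨Fin.last k - r, ?_, ?_⟩
  · simp only [sub_add_cancel, specialWalk_val, Fin.val_last]; omega
  · have h0 : Fin.last k - r + 1 + r = 0 := by
      rw [sub_add_eq_add_sub, sub_add_cancel, Fin.last_add_one]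
    simp only [h0, specialWalk_val, Fin.val_zero, add_zero, le_refl]

/-- Rotations of the special walk climb by at most one at each step. [folklore] -/
theorem noBigJump_rotate_specialWalk (hkn : k + 1 ≤ n) (r a : Fin (k + 1)) :
    (specialWalk n k hkn (a + 1 + r)).val ≤ (specialWalk n k hkn (a + r)).val + 1 := by
  rw [add_right_comm]
  generalize a + r = x
  rw [specialWalk_val, specialWalk_val]
  rcases (Fin.le_last x).eq_or_lt with h | h
  · rw [h, Fin.last_add_one, Fin.val_zero]
    omega
  · rw [Fin.val_add_one_of_lt h]
    omega

end Slice

/-! ### 3. Triangularity of the Gelfand–Casimir symbols -/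

section Main

variable {c : Fin n → R} {Z : Matrix (Fin n) (Fin n) R} {k : ℕ}

/-- The `k + 1` rotations of the special walk are pairwise distinct. [folklore] -/
theorem rotate_specialWalk_injective (hkn : k + 1 ≤ n) :
    Function.Injective fun r : Fin (k + 1) => (fun a => specialWalk n k hkn (a + r)) := by
  intro r r' h
  have h0 := congrArg Fin.val (congrFun h (-r))
  simp only [neg_add_cancel, specialWalk_val, Fin.val_zero, add_zero] at h0
  have h1 : (-r + r').val = 0 := by omega
  have h2 : -r + r' = 0 := Fin.ext h1
  rw [neg_add_eq_zero] at h2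
  exact h2

/-- **Triangularity of the Gelfand–Casimir symbols on the mirabolic slice.** For `Z` with
superdiagonal `c` and zeros above it, and `1 ≤ k + 1 ≤ n`,
`trace (Z^{k+1}) = trace (Z'^{k+1}) + (k+1) · (c_j ⋯ c_{n-2}) · Z_{n-1, j}`, `j = n - (k+1)`, where `Z'`
zeroes the last-row entries `Z_{n-1,i}`, `i ≤ j`: the symbol of the degree-`(k+1)` generator of
`𝔷(𝔤𝔩_n)` does not see `Z_{n-1,i}` for `i < j` and sees `Z_{n-1,j}` linearly with coefficient
`(k+1) Π c` (closed walks through a zeroed entry are the rotations of `j → j+1 → ⋯ → n-1 → j` or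
contain a step climbing by `≥ 2`). [cite: Kostant1978Whittaker, §2] -/
theorem trace_pow_eq_trace_pow_zeroLastRow_add (hZ : IsMirabolicSlice c Z) (hkn : k + 1 ≤ n) :
    trace (Z ^ (k + 1)) = trace ((zeroLastRow (n - (k + 1)) Z) ^ (k + 1)) +
      ((k + 1 : ℕ) : R) * ((∏ m : Fin k, c ⟨n - (k + 1) + m.val, by have := m.isLt; omega⟩) *
        Z ⟨n - 1, by omega⟩ ⟨n - (k + 1), by omega⟩) := by
  classical
  rw [trace_pow_eq_sum_cycProd, trace_pow_eq_sum_cycProd]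
  set S : Finset (Fin (k + 1) → Fin n) :=
    Finset.univ.image fun r : Fin (k + 1) => fun a => specialWalk n k hkn (a + r) with hS
  have key : ∀ w : Fin (k + 1) → Fin n,
      cycProd Z w = cycProd (zeroLastRow (n - (k + 1)) Z) w + if w ∈ S then cycProd Z w else 0 := by
    intro w
    by_cases hP : UsesZeroed n k w
    · rw [cycProd_zeroLastRow_of hP, zero_add]
      by_cases hno : ∀ a : Fin (k + 1), (w (a + 1)).val ≤ (w a).val + 1
      · obtain ⟨r, hr⟩ := eq_rotate_specialWalk_of_noBigJump hkn hP hno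
        rw [if_pos (Finset.mem_image.2 ⟨r, Finset.mem_univ _, hr.symm⟩)]
      · push Not at hno
        obtain ⟨a, ha⟩ := hno
        rw [cycProd_eq_zero_of_bigJump hZ ⟨a, by omega⟩]
        split_ifs <;> rfl
    · rw [cycProd_zeroLastRow_of_not hP, if_neg, add_zero]
      intro hw
      obtain ⟨r, -, hr⟩ := Finset.mem_image.1 hw
      exact hP (hr ▸ usesZeroed_rotate_specialWalk hkn r)
  rw [Finset.sum_congr rfl fun w _ => key w, Finset.sum_add_distrib]
  congr 1
  rw [Finset.sum_ite_mem, Finset.univ_inter, hS,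
    Finset.sum_image fun r _ r' _ h => rotate_specialWalk_injective hkn h]
  simp only [cycProd_rotate, cycProd_specialWalk hZ hkn, Finset.sum_const, Finset.card_univ,
    Fintype.card_fin, nsmul_eq_mul]

/-- **Corollary (the variables seen).** On the slice, `trace (Z^{k+1})` depends on the last row only
through `Z_{n-1,i}`, `i ≥ n - (k+1)`: if `Z₁, Z₂` are slice matrices agreeing off the entries
`(n-1, i)`, `i < n - (k+1)`, then `trace (Z₁^{k+1}) = trace (Z₂^{k+1})`. [cite: Kostant1978Whittaker, §2] -/
theorem trace_pow_eq_of_eq_off_lowLastRow (hZ₁ : IsMirabolicSlice c Z) {Z₂ : Matrix (Fin n) (Fin n) R}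
    (hZ₂ : IsMirabolicSlice c Z₂) (hkn : k + 1 ≤ n)
    (h : ∀ a b : Fin n, ¬ (a.val = n - 1 ∧ b.val < n - (k + 1)) → Z a b = Z₂ a b) :
    trace (Z ^ (k + 1)) = trace (Z₂ ^ (k + 1)) := by
  rw [trace_pow_eq_trace_pow_zeroLastRow_add hZ₁ hkn, trace_pow_eq_trace_pow_zeroLastRow_add hZ₂ hkn]
  have hzero : zeroLastRow (n - (k + 1)) Z = zeroLastRow (n - (k + 1)) Z₂ := by
    ext a b
    rw [zeroLastRow_apply, zeroLastRow_apply]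
    split_ifs with hab
    · rfl
    · refine h a b fun hab' => hab ⟨hab'.1, hab'.2.le⟩
  have hcorner : Z ⟨n - 1, by omega⟩ ⟨n - (k + 1), by omega⟩ = Z₂ ⟨n - 1, by omega⟩ ⟨n - (k + 1), by omega⟩ :=
    h _ _ fun hab => absurd hab.2 (lt_irrefl _)
  rw [hzero, hcorner]

end Main

end Literature.Algebra.Lie.MirabolicKostant
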